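import Summits.QuantumFields.YangMills.Theorems.LuscherReductionOneSiteLevelsKacInner
import Summits.QuantumFields.YangMills.Theorems.FlatTubeReductionOneSiteQuasimodeCopies
import HarnessLib

/-!
# The eigen-scale annulus in crux ONE's Kac currency: lattice jump bound from a flat bound, support transfer, and the `cos Θ_B`-piece rate
# (route `FlatTubeReduction`, crux K1 `NearFlatRatioLaw` stmt-QuantumFields-24720, skeleton «ratepack-v2», stub `stub_outerCoercive`; seat `ym-line-ftr-p1` g11;
# R2b1 RECORD rung — no summit statement is proved here)

Lattice side of the eigen-scale OUTER COERCIVITY (B. Simon's confinement at the scale `R·λ_b` of the one-site eigenfunctions).  Everything is crux ONE's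
monotone gnomonic flattening VERBATIM (`jumpEnergyLower_of_flatKacAt`, seat ym-luscher-20007-p2): for a physical `ψ` with inner piece `g = e^{−BS/2}·cos Θ_B·ψ` and flat
representative `G = gFlat B ψ` on `ℝ⁹` (chart scale `μ = λ_b/2`, support `‖y‖ ≤ 7/√λ_b`), the five analytic inputs `∫g² ≤ 8ρ₀∫G²` (`integral_sq_le_of_chartRep`),
`∫BSg² ≥ 8ρ₀λ(1−98λ)∫VG²` (`integral_action_mul_sq_ge`), `latticeJump ≥ 8ρ₀λ(1−294λ)²·flatJumpBall` (`latticeJump_ge_flatJumpBall`), the Gaussian tail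
(`flatJump_le_flatJumpBall_add_exp`) and a FLAT Kac-form bound `(E − Cλ)∫G² ≤ kacForm λ G` give `(Eλ − C₁λ²)∫g² ≤ latticeJump B g + ∫BSg²` (`assembly_ineq`) — here with the flat
bound taken as a hypothesis ON `G` ITSELF (`jump_lower_of_flatRep`, no orthogonality constraints), so that any flat statement about the support of `G` can be plugged in.
* §1 `jump_lower_of_flatRep` (per-`ψ` layer II) and `cosRate_of_flatRep` (layer I on top: `qform(cosΘψ) ≤ linkCE·e^{−Eλ+C₁λ²}‖cosΘψ‖²`, via `qform_le_of_latticeJump_ge`).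
* §2 SUPPORT TRANSFER `le_norm_of_gFlat_ne_zero`: if `ψ` vanishes on the toron window `{orbitDist < R·λ_b}` then `G` vanishes on `{‖y‖ < R/(3√3)}` (`orbitDist_le_of_upper`:
  `orbitDist (gnChart μ pos y) ≤ 6√3·μ‖y‖`).
* §3 ★★ `cosRate_of_flatAnnulus`: a flat annulus Kac-form bound at support radius `κ = 7` (`∃ R' C t₀ …`, the shape of `RateTube.flatKac_annulus`) implies, for `B ≥ B₁`, the absolute
  rate `qform(cosΘ_Bψ) ≤ linkCE B·e^{−Eλ_b + C₁λ_b²}·‖cosΘ_Bψ‖²` for every physical `ψ` vanishing on `⋃_z{orbitDist(τ_z·) < 3√3R'·λ_b}`.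
HONEST FRAMING: lattice bookkeeping at one site (`L = 1`); femto rung R2b1 (RECORD label); not infinite volume, not a gap, not Clay.  No defs, no named facts, no `sorry`.
-/

set_option autoImplicit false

noncomputable section

open MeasureTheory Filter Topology Real
open scoped BigOperators
open Literature.MathematicalPhysics.QuantumFieldTheory
open Literature.MathematicalPhysics.QuantumLattice
open Literature.Analysis.OperatorTheory.YMMatrixModel

namespace Summit.QuantumFields.YangMills.Theorems.FemtoTransferGap.RateTube

open Summit.QuantumFields.YangMills.Theorems.FemtoTransferGap

/-! ### §1. Layer II per test function: the lattice jump bound from a flat Kac bound on the representative -/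

/-- ★ **Per-`ψ` monotone flattening.**  `2 ≤ B`, `λ_b(B) ≤ 1/600`, `ψ` physical, `g = e^{−BS/2}cos Θ_B ψ`, `G = gFlat B ψ`: a flat bound `(E − Cλ_b)∫G² ≤ kacForm λ_b G` gives
`(Eλ_b − (600E + 601|C| + 2)λ_b²)∫g² ≤ latticeJump B g + ∫ B·S·g²` — the body of crux ONE's `jumpEnergyLower_of_flatKacAt` with the flat Kac-form bound supplied for THIS `G`.
[cite: Luscher1983, §3] [cite: SimonB1983DiscreteSpectrum, §3] -/
theorem jump_lower_of_flatRep {B E C : ℝ} (hB2 : 2 ≤ B) (ht600 : bareLambda B ≤ 1 / 600) {ψ : Cfg → ℝ} (hψ : IsPhys ψ)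
    (hK : (E - C * bareLambda B) * ∫ y, gFlat B ψ y ^ 2 ≤ kacForm (bareLambda B) (gFlat B ψ)) :
    (E * bareLambda B - (600 * E + 601 * |C| + 2) * bareLambda B ^ 2) *
        ∫ U, magWeight B (fun U => Real.cos (onePhase (onePhaseScale B) U) * ψ U) U ^ 2 ∂cfgMeasure ≤
      latticeJump B (magWeight B (fun U => Real.cos (onePhase (onePhaseScale B) U) * ψ U)) +
        ∫ U, B * wilsonAction su2Rep U * magWeight B (fun U => Real.cos (onePhase (onePhaseScale B) U) * ψ U) U ^ 2 ∂cfgMeasure := by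
  have hBpos : 0 < B := by linarith
  have ht : 0 < bareLambda B := bareLambda_pos' hBpos
  have ht4 : bareLambda B ≤ 1 / 4 := by linarith
  have hBt : B = 2 / bareLambda B ^ 3 := by
    have h := bareLambda_cube hBpos
    field_simp
    linarith
  have hμ : 0 < bareLambda B / 2 := by positivity
  have hsq : Real.sqrt (bareLambda B) ^ 2 = bareLambda B := Real.sq_sqrt ht.le
  have hsqpos : 0 < Real.sqrt (bareLambda B) := Real.sqrt_pos.2 ht
  have hR₀ : (0 : ℝ) ≤ 7 / Real.sqrt (bareLambda B) := by positivity
  have hμR₀ : (bareLambda B / 2) ^ 2 * (7 / Real.sqrt (bareLambda B)) ^ 2 = 49 / 4 * bareLambda B := by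
    rw [div_pow, div_pow, hsq]; field_simp; ring
  have hρ₀ : 0 < (bareLambda B / 2) ^ 9 * ((2 * π ^ 2)⁻¹) ^ 3 := by positivity
  have hwin6 : 6 * ((bareLambda B / 2) ^ 2 * (7 / Real.sqrt (bareLambda B)) ^ 2) ≤ 1 := by rw [hμR₀]; linarith
  have h4R : (bareLambda B / 2) ^ 2 * (2 * (7 / Real.sqrt (bareLambda B))) ^ 2 =
      4 * ((bareLambda B / 2) ^ 2 * (7 / Real.sqrt (bareLambda B)) ^ 2) := by ring
  have hR6 : 6 * ((bareLambda B / 2) ^ 2 * (2 * (7 / Real.sqrt (bareLambda B))) ^ 2) ≤ 1 := by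
    rw [h4R, hμR₀]; linarith
  -- the test function and its flat representative
  obtain ⟨Cψ, hCψ⟩ := hψ.bounded
  have hfphys : IsPhys (fun U => Real.cos (onePhase (onePhaseScale B) U) * ψ U) := isPhys_cos_onePhase_mul _ hψ
  have hfb' : ∀ U : Cfg, |Real.cos (onePhase (onePhaseScale B) U) * ψ U| ≤ Cψ := fun U => by
    rw [abs_mul]
    exact (mul_le_of_le_one_left (abs_nonneg _) (Real.abs_cos_le_one _)).trans (hCψ U)
  set g : Cfg → ℝ := magWeight B (fun U => Real.cos (onePhase (onePhaseScale B) U) * ψ U) with hg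
  have hgm : Measurable g := measurable_magWeight B hfphys.measurable
  have hgb : ∀ U, |g U| ≤ Cψ := magWeight_bounded hBpos.le hfb'
  set G : ZM → ℝ := gFlat B ψ with hG
  have hrep : ∀ σ y, g (gnChart (bareLambda B / 2) σ y) = G y := fun σ y => magWeight_cos_gnChart hψ B σ y
  have hGm : Measurable G := measurable_gFlat B hψ.measurable
  have hGb : ∀ y, |G y| ≤ Cψ := abs_gFlat_le hBpos.le hCψ
  have hGsupp : ∀ y, G y ≠ 0 → ‖y‖ ≤ 7 / Real.sqrt (bareLambda B) := fun y hy => norm_le_of_gFlat_ne_zero hBpos ht4 hy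
  have hG2i : Integrable fun y => G y ^ 2 := integrable_sq_of_bounded_of_support hGm hGb hGsupp
  have hVi : Integrable fun y => luscherPotential y * G y ^ 2 := integrable_potential_mul_sq hGm hGb hGsupp
  -- the five analytic inputs
  have hM : ∫ U, g U ^ 2 ∂cfgMeasure ≤ 8 * ((bareLambda B / 2) ^ 9 * ((2 * π ^ 2)⁻¹) ^ 3) * ∫ y, G y ^ 2 :=
    integral_sq_le_of_chartRep hμ hgm ⟨Cψ, hgb⟩ hrep hG2i
  have hM0 : 0 ≤ ∫ U, g U ^ 2 ∂cfgMeasure := integral_nonneg fun U => sq_nonneg _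
  have hV := integral_action_mul_sq_ge hBpos.le hμ hgm ⟨Cψ, hgb⟩ hrep hGsupp hwin6 hVi
  have hJ := latticeJump_ge_flatJumpBall ht hgm hgb hGm hGb hrep hR6
  rw [← hBt] at hJ
  have hT := flatJump_le_flatJumpBall_add_exp ht hGm hGb hR₀ hGsupp
  rw [kacForm] at hK
  -- constants in the inputs
  have e8 : 8 * B * (bareLambda B / 2) ^ 4 = bareLambda B := by
    linear_combination (bareLambda B / 2) * bareLambda_cube hBpos
  have e98 : 1 - 8 * ((bareLambda B / 2) ^ 2 * (7 / Real.sqrt (bareLambda B)) ^ 2) = 1 - 98 * bareLambda B := by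
    rw [hμR₀]; ring
  have e294 : 1 - 6 * ((bareLambda B / 2) ^ 2 * (2 * (7 / Real.sqrt (bareLambda B))) ^ 2) = 1 - 294 * bareLambda B := by
    rw [h4R, hμR₀]; ring
  have e49 : (7 / Real.sqrt (bareLambda B)) ^ 2 / (4 * bareLambda B) = 49 / (4 * bareLambda B ^ 2) := by
    rw [div_pow, hsq]; field_simp; ring
  rw [e8, e98] at hV
  rw [e294] at hJ
  rw [e49] at hT
  exact assembly_ineq ht ht600 hρ₀ hM0 hM (integral_nonneg fun y => sq_nonneg _)
    (flatJumpBall_nonneg ht _ _) (integral_nonneg fun y => mul_nonneg (luscherPotential_nonneg y) (sq_nonneg _))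
    (latticeJump_nonneg hBpos.le g)
    (integral_nonneg fun U => mul_nonneg (mul_nonneg hBpos.le (wilsonAction_su2_nonneg U)) (sq_nonneg _)) hJ hV hT hK

/-- ★ **Layers I + II per test function.**  Under the hypotheses of `jump_lower_of_flatRep`:
`qform(cosΘ_Bψ) ≤ linkCE B·e^{−Eλ_b + (600E + 601|C| + 2)λ_b²}·‖cosΘ_Bψ‖²` (`qform_le_of_latticeJump_ge`). [cite: Luscher1983, §3] [cite: LiebYau1988, (2.9)–(2.11)] -/
theorem cosRate_of_flatRep {B E C : ℝ} (hB2 : 2 ≤ B) (ht600 : bareLambda B ≤ 1 / 600) {ψ : Cfg → ℝ} (hψ : IsPhys ψ)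
    (hK : (E - C * bareLambda B) * ∫ y, gFlat B ψ y ^ 2 ≤ kacForm (bareLambda B) (gFlat B ψ)) :
    qform su2Rep B (fun U => Real.cos (onePhase (onePhaseScale B) U) * ψ U) (fun U => Real.cos (onePhase (onePhaseScale B) U) * ψ U)
      ≤ linkCE B * Real.exp (-(E * bareLambda B) + (600 * E + 601 * |C| + 2) * bareLambda B ^ 2)
        * l2 (fun U => Real.cos (onePhase (onePhaseScale B) U) * ψ U) (fun U => Real.cos (onePhase (onePhaseScale B) U) * ψ U) := by
  have hBpos : 0 < B := by linarith
  have key := qform_le_of_latticeJump_ge (a := E * bareLambda B - (600 * E + 601 * |C| + 2) * bareLambda B ^ 2) hBpos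
    (isPhys_cos_onePhase_mul (onePhaseScale B) hψ) (jump_lower_of_flatRep hB2 ht600 hψ hK)
  have e : -(E * bareLambda B - (600 * E + 601 * |C| + 2) * bareLambda B ^ 2) =
      -(E * bareLambda B) + (600 * E + 601 * |C| + 2) * bareLambda B ^ 2 := by ring
  rw [e] at key
  exact key

/-! ### §2. Support transfer: toron windows in `orbitDist` ↦ balls in the chart -/

/-- ★ **Support transfer.**  If the physical `ψ` vanishes wherever some twist copy is within `R·λ_b` of the vacuum orbit, then its flat representative `gFlat B ψ` vanishes on
`{‖y‖ < R/(3√3)}`: the chart point `gnChart (λ_b/2) pos y` is all-upper with `gnCoord = y`, so `orbitDist ≤ 6√3·(λ_b/2)·‖y‖` (`orbitDist_le_of_upper`). [folklore] -/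
theorem le_norm_of_gFlat_ne_zero {B R : ℝ} (hB : 0 < B) {ψ : Cfg → ℝ}
    (hR : ∀ U, ψ U ≠ 0 → ∀ z : Fin 3 → Bool, R * bareLambda B ≤ orbitDist (TT.twist3 z U)) {y : ZM} (hy : gFlat B ψ y ≠ 0) :
    R ≤ 3 * Real.sqrt 3 * ‖y‖ := by
  have ht : 0 < bareLambda B := bareLambda_pos' hB
  have hμ : 0 < bareLambda B / 2 := by positivity
  set U : Cfg := gnChart (bareLambda B / 2) pos y with hU
  have hψU : ψ U ≠ 0 := by
    intro h0; apply hy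
    show magFlat B y * (Real.cos (thetaFlat B y) * chartFn (bareLambda B / 2) ψ y) = 0
    rw [chartFn, ← hU, h0, mul_zero, mul_zero]
  have h1 : R * bareLambda B ≤ orbitDist U := by
    have h := hR U hψU (fun _ => false)
    rwa [TT.twist3_false] at h
  have hup : ∀ e : Edge 3 1, 0 < scalarPart (U e) := (Quasimode.upper_gnChart_iff (bareLambda B / 2) pos y).2 rfl
  have hcoord : ‖gnCoord (bareLambda B / 2) U‖ ≤ ‖y‖ := by rw [hU, gnCoord_gnChart hμ.ne']
  have h2 : orbitDist U ≤ 6 * Real.sqrt 3 * (bareLambda B / 2) * ‖y‖ := Quasimode.orbitDist_le_of_upper hμ hup hcoord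
  have h3 : R * bareLambda B ≤ (3 * Real.sqrt 3 * ‖y‖) * bareLambda B := by
    calc R * bareLambda B ≤ 6 * Real.sqrt 3 * (bareLambda B / 2) * ‖y‖ := h1.trans h2
      _ = (3 * Real.sqrt 3 * ‖y‖) * bareLambda B := by ring
  exact le_of_mul_le_mul_right h3 ht

/-! ### §3. The `cos Θ_B`-piece of the eigen-scale outer coercivity from a flat annulus bound -/

/-- ★★ **The `cos Θ_B`-piece rate from a FLAT annulus Kac-form bound.**  Suppose that on `ℝ⁹`, for support radius `κ = 7`, there are `R' > 0`, `C`, `t₀ > 0` such that every measurable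
bounded colour-invariant `G` supported in `{R' ≤ ‖y‖ ≤ 7/√t}` obeys `(E − Ct)∫G² ≤ kacForm t G` (`0 < t ≤ t₀`).  Then for `B ≥ max 2 (2/t₁³)` (`t₁ = min t₀ (1/600)`) every physical
`ψ` vanishing on `⋃_z {orbitDist(τ_z ·) < 3√3R'·λ_b(B)}` has `qform(cosΘ_Bψ) ≤ linkCE B·e^{−Eλ_b + (600E + 601|C| + 2)λ_b²}·‖cosΘ_Bψ‖²`.
[cite: SimonB1983DiscreteSpectrum, §3] [cite: Luscher1983, §3] -/
theorem cosRate_of_flatAnnulus {E : ℝ}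
    (hflat : ∃ R' C t₀ : ℝ, 0 < R' ∧ 0 < t₀ ∧ ∀ t : ℝ, 0 < t → t ≤ t₀ → ∀ G : ZM → ℝ, Measurable G → (∃ M : ℝ, ∀ x, |G x| ≤ M) →
      IsGaugeInv G → (∀ x, G x ≠ 0 → ‖x‖ ≤ 7 / Real.sqrt t) → (∀ x, G x ≠ 0 → R' ≤ ‖x‖) →
        (E - C * t) * ∫ x, G x ^ 2 ≤ kacForm t G) :
    ∃ R B₁ C₁ : ℝ, 0 < R ∧ 2 ≤ B₁ ∧ ∀ B : ℝ, B₁ ≤ B → ∀ ψ : Cfg → ℝ, IsPhys ψ →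
      (∀ U, ψ U ≠ 0 → ∀ z : Fin 3 → Bool, R * bareLambda B ≤ orbitDist (TT.twist3 z U)) →
        qform su2Rep B (fun U => Real.cos (onePhase (onePhaseScale B) U) * ψ U) (fun U => Real.cos (onePhase (onePhaseScale B) U) * ψ U)
          ≤ linkCE B * Real.exp (-(E * bareLambda B) + C₁ * bareLambda B ^ 2)
            * l2 (fun U => Real.cos (onePhase (onePhaseScale B) U) * ψ U) (fun U => Real.cos (onePhase (onePhaseScale B) U) * ψ U) := by
  obtain ⟨R', C, t₀, hR', ht₀, hbound⟩ := hflat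
  set t₁ : ℝ := min t₀ (1 / 600) with ht₁
  have ht₁pos : 0 < t₁ := lt_min ht₀ (by norm_num)
  refine ⟨3 * Real.sqrt 3 * R', max 2 (2 / t₁ ^ 3), 600 * E + 601 * |C| + 2, by positivity, le_max_left _ _,
    fun B hB ψ hψ hsupp => ?_⟩
  have hB2 : 2 ≤ B := (le_max_left _ _).trans hB
  have hBpos : 0 < B := by linarith
  have ht : 0 < bareLambda B := bareLambda_pos' hBpos
  have ht1' : bareLambda B ≤ t₁ := bareLambda_le_of_le ht₁pos ((le_max_right _ _).trans hB)
  have htt₀ : bareLambda B ≤ t₀ := ht1'.trans (min_le_left _ _)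
  have ht600 : bareLambda B ≤ 1 / 600 := ht1'.trans (min_le_right _ _)
  have ht4 : bareLambda B ≤ 1 / 4 := by linarith
  obtain ⟨Cψ, hCψ⟩ := hψ.bounded
  -- the flat representative is a datum of the flat annulus bound
  have hGm : Measurable (gFlat B ψ) := measurable_gFlat B hψ.measurable
  have hGb : ∀ y, |gFlat B ψ y| ≤ Cψ := abs_gFlat_le hBpos.le hCψ
  have hGinv : IsGaugeInv (gFlat B ψ) := isGaugeInv_gFlat B hψ
  have hGsupp : ∀ y, gFlat B ψ y ≠ 0 → ‖y‖ ≤ 7 / Real.sqrt (bareLambda B) := fun y hy => norm_le_of_gFlat_ne_zero hBpos ht4 hy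
  have hGvan : ∀ y, gFlat B ψ y ≠ 0 → R' ≤ ‖y‖ := fun y hy => by
    have h := le_norm_of_gFlat_ne_zero hBpos hsupp hy
    have h3 : 0 < 3 * Real.sqrt 3 := by positivity
    rw [mul_assoc] at h
    exact le_of_mul_le_mul_left (by linarith [h]) h3
  have hK := hbound (bareLambda B) ht htt₀ (gFlat B ψ) hGm ⟨Cψ, hGb⟩ hGinv hGsupp hGvan
  exact cosRate_of_flatRep hB2 ht600 hψ hK

end Summit.QuantumFields.YangMills.Theorems.FemtoTransferGap.RateTube

end
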